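import Summits.AtomisticToContinuum.Crystallization.Theses.ReggeStarCoercivity
import Summits.AtomisticToContinuum.Crystallization.Theses.PalmUnimodularRigidity
import Summits.AtomisticToContinuum.Crystallization.Theorems.DefectFreeCrystallizes.Negative.PredicateAPI
import Summits.AtomisticToContinuum.Crystallization.Theorems.ReggeStarCoercivityDefectFreeCrystallizesPalmDefs
import Summits.AtomisticToContinuum.Crystallization.Theorems.ReggeStarCoercivityDefectFreeCrystallizesGoodLaw
import Summits.AtomisticToContinuum.Crystallization.Theorems.ReggeStarCoercivityDefectFreeCrystallizesFunnelChart
import Summits.AtomisticToContinuum.Crystallization.Theorems.ReggeStarCoercivityDefectFreeCrystallizesChargeFromFunnelLaw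
import Summits.AtomisticToContinuum.Crystallization.Theorems.ReggeStarCoercivityDefectFreeCrystallizesRouteBetaFloor
import Summits.AtomisticToContinuum.Crystallization.Theorems.ReggeStarCoercivityDefectFreeCrystallizesDefectVersion
import Summits.AtomisticToContinuum.Crystallization.Theorems.ReggeStarCoercivityDefectFreeCrystallizesAnnulusCount
import Summits.AtomisticToContinuum.Crystallization.Theorems.PalmUnimodularRigidityChargedPatternCrystallizes
import Summits.AtomisticToContinuum.Crystallization.Theorems.PalmUnimodularRigidityLayeredLawsSelectHcpDefs
import Summits.AtomisticToContinuum.Crystallization.Theorems.PalmUnimodularRigidityLayeredLawsSelectHcpRelaxedReference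
import Summits.AtomisticToContinuum.Crystallization.Theorems.PalmUnimodularRigidityCruxesToPalmRigidity
import Summits.AtomisticToContinuum.Crystallization.Theorems.ExcessDecayLiouvilleCoarseGrainsHcpEnergySeries
import Literature.Probability.Process.PointStationaryLaw
import Literature.MathematicalPhysics.StatisticalMechanics.BarlowStacking
import Literature.MathematicalPhysics.StatisticalMechanics.LennardJonesClusters
import Literature.Geometry.DiscreteGeometry.KissingPatterns
import Summits.AtomisticToContinuum.Crystallization.Theorems.ReggeStarCoercivityDefectFreeCrystallizesExactFrameH
import Summits.AtomisticToContinuum.Crystallization.Theorems.ReggeStarCoercivityDefectFreeCrystallizesExactFrameC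
import Summits.AtomisticToContinuum.Crystallization.Theorems.ReggeStarCoercivityDefectFreeCrystallizesFramePropagation
import Summits.AtomisticToContinuum.Crystallization.Theorems.ReggeStarCoercivityDefectFreeCrystallizesExactSelectionLawB
import Summits.AtomisticToContinuum.Crystallization.Theorems.MinMeanCycleStackingLockBarlowEnergyIdentification
import Summits.AtomisticToContinuum.Crystallization.Theorems.ReggeStarCoercivityDefectFreeCrystallizesExactStarShortcutRigidity
import Summits.AtomisticToContinuum.Crystallization.Theorems.ReggeStarCoercivityDefectFreeCrystallizesExactStarShortcut

/-!
# The exact-star shortcut, IV: the residue of crux `ReggeStarCoercivity.DefectFreeCrystallizes` in GROUND-STATE form (lead c9, v32)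

`ExactStarShortcutEquality.defectFreeCrystallizes_of_equality` (p163042; not imported here, farm build order) asks FUNNEL EQUALITY of all funnel laws with
`E_P[h] ≤ hcpE a₀ h₀`.  The crux consumes it only on the good limit law, which is a GROUND-STATE law (`E_P[h] ≤ e*`, the periodic
infimum; `e* ≤ hcpE a₀ h₀` is the landed `RouteBetaFloor.iInf_le_hcpE`).  So the honest residue is GROUND-STATE FUNNEL EQUALITY — the
registered stub `stub_funnelEquality` of the skeleton v32, = the hypothesis `hEQ` below verbatim: a point-stationary rooted hard-core
GROUND-STATE law a.s. carried by everywhere-`SetGood` Barlow-charted force-balanced configurations with zero mean virial stress has a.s. an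
exact relaxed-hcp or regular-fcc root star and an empty annulus `(11/10, 5/4]`.  Its prover may use the full minimality structure
(item 9229: every point-stationary hard-core law has `E ≥ e*`, so these laws MINIMISE; a.s. μGSC from 9226's line).  With item 3061
(`HcpPeriodicMinimiser`, verbatim — its route file cannot be imported next to `MuGSC`, see part III) it proves the crux:
`defectFreeCrystallizes_of_groundStateEquality`.  All `[folklore]`.
-/

noncomputable section

open scoped BigOperators ENNReal
open Filter Topology MeasureTheory

namespace Summit.AtomisticToContinuum.Crystallization.Theorems.PalmGoodLaw.ExactStarShortcutGroundState

open Summit.AtomisticToContinuum.Crystallization.Theses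
open Summit.AtomisticToContinuum.Crystallization.Theses.ReggeStarCoercivity
open Summit.AtomisticToContinuum.Crystallization.Theorems.DefectFreeCrystallizes.Negative.PredicateAPI
open Literature.MathematicalPhysics.StatisticalMechanics Literature.Geometry.DiscreteGeometry
open Literature.Probability.Process
open Summit.AtomisticToContinuum.Crystallization.Theorems.PalmGoodLaw (SetGood)



section ExactStarGlue

open Summit.AtomisticToContinuum.Crystallization.Theorems.PalmUnimodularRigidity.LayeredLawsSelectHcp
  (hcpE hcpQ hcpSite hcpStarIdx rootStar starDefect starDefect_nonneg stub_relaxedReference)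
open Summit.AtomisticToContinuum.Crystallization.Theorems.PalmUnimodularRigidity
  (ae_forall_map_sub_of_ae count_restrict_floorNorm_preimage_lt_top)

/-- **Item 3061 pins the level** (copy of `ExactStarShortcutEquality.hcpE_eq_iInf_of_hcpPeriodicMinimiser`, p163042, kept private to this
file so that it does not wait for that module's farm build): `hcpE a₀ h₀ = e*` by the sandwich `e* ≤ hcpE a₀ h₀ ≤ hcpE a h = e*`. [folklore] -/
private theorem hcpE_eq_iInf_of_isLeast
    (h3061 : ∃ a h : ℝ, ∃ (ha : a ≠ 0) (hh : h ≠ 0), 47 / 50 ≤ a ∧ a ≤ 1 ∧ 39 / 50 * a ≤ h ∧ h ≤ 17 / 20 * a ∧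
      IsLeast (Set.range fun Q : Literature.MathematicalPhysics.StatisticalMechanics.PeriodicConfiguration 3 =>
          Q.energyPerParticle Literature.MathematicalPhysics.StatisticalMechanics.lennardJones)
        ((Literature.MathematicalPhysics.StatisticalMechanics.hcpPeriodicConfiguration ha hh).energyPerParticle
          Literature.MathematicalPhysics.StatisticalMechanics.lennardJones))
    {a₀ h₀ : ℝ} (ha0 : 0 < a₀) (hh0 : 0 < h₀) (hmin : ∀ a h : ℝ, 0 < a → 0 < h → hcpE a₀ h₀ ≤ hcpE a h) :
    hcpE a₀ h₀ = ⨅ Q : PeriodicConfiguration 3, Q.energyPerParticle lennardJones := by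
  obtain ⟨a, h, ha, hh, h1, -, h3, -, hleast⟩ := h3061
  have hapos : 0 < a := by linarith
  have hhpos : 0 < h := by nlinarith
  have hser : (hcpPeriodicConfiguration ha hh).energyPerParticle lennardJones = hcpE a h :=
    (Summit.AtomisticToContinuum.Crystallization.Theorems.ExcessDecayLiouvilleCoarseGrains.hcpEnergySeries_of_eq
      a h ha hh hcpQ rfl).2.2
  have hinf : (⨅ Q : PeriodicConfiguration 3, Q.energyPerParticle lennardJones) = hcpE a h := by
    rw [← hser]
    exact hleast.csInf_eq
  refine le_antisymm ?_ (Summit.AtomisticToContinuum.Crystallization.Theorems.PalmGoodLaw.RouteBetaFloor.iInf_le_hcpE ha0.ne' hh0.ne')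
  rw [hinf]
  exact hmin a h hapos hhpos

/-- **Item 3061 + GROUND-STATE FUNNEL EQUALITY ⇒ funnel law rigidity** — the same as `funnelLawRigidity_of_equality` with the
equality hypothesis asked only of GROUND-STATE laws (`E_P[h] ≤ e*`, the periodic infimum) instead of `E_P[h] ≤ hcpE a₀ h₀`: weaker (the
landed `RouteBetaFloor.iInf_le_hcpE` gives `e* ≤ hcpE a₀ h₀`) and still sufficient, since the good limit law IS a ground-state law; a prover
of the ground-state form may use the full minimality structure (a.s. μGSC, item 9229's floor `E ≥ e*`). [folklore] -/
theorem funnelLawRigidity_of_groundStateEquality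
    (h3061 : ∃ a h : ℝ, ∃ (ha : a ≠ 0) (hh : h ≠ 0), 47 / 50 ≤ a ∧ a ≤ 1 ∧ 39 / 50 * a ≤ h ∧ h ≤ 17 / 20 * a ∧
      IsLeast (Set.range fun Q : Literature.MathematicalPhysics.StatisticalMechanics.PeriodicConfiguration 3 =>
          Q.energyPerParticle Literature.MathematicalPhysics.StatisticalMechanics.lennardJones)
        ((Literature.MathematicalPhysics.StatisticalMechanics.hcpPeriodicConfiguration ha hh).energyPerParticle
          Literature.MathematicalPhysics.StatisticalMechanics.lennardJones))
    (hEQ : ∀ a₀ h₀ : ℝ, 189 / 200 ≤ a₀ → a₀ ≤ 199 / 200 → 77 / 100 ≤ h₀ → h₀ ≤ 163 / 200 →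
      (∀ a h : ℝ, 0 < a → 0 < h → hcpE a₀ h₀ ≤ hcpE a h) →
      ∀ δ : ℝ, 0 < δ → ∀ P : Measure (Measure (EuclideanSpace ℝ (Fin 3))), IsProbabilityMeasure P →
        (∀ᵐ μ ∂P, IsRootedHardCore δ μ) → IsPointStationaryLaw P →
        (∀ᵐ μ ∂P, ∃ S : Set (EuclideanSpace ℝ (Fin 3)),
          μ = (Measure.count : Measure (EuclideanSpace ℝ (Fin 3))).restrict S ∧
          (∀ y ∈ S, SetGood S y) ∧
          ∃ s : ℤ → ℤ, IsHaggSeq s ∧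
            ∃ Φ : EuclideanSpace ℝ (Fin 3) → EuclideanSpace ℝ (Fin 3),
              Set.BijOn Φ (barlowStacking 1 (Real.sqrt (2 / 3)) s) S ∧
              ∀ p ∈ barlowStacking 1 (Real.sqrt (2 / 3)) s, ∀ q ∈ barlowStacking 1 (Real.sqrt (2 / 3)) s,
                (dist p q = 1 ↔ (0 < dist (Φ p) (Φ q) ∧ dist (Φ p) (Φ q) < 6 / 5))) →
        (∀ᵐ μ ∂P, ∃ S : Set (EuclideanSpace ℝ (Fin 3)),
          μ = (Measure.count : Measure (EuclideanSpace ℝ (Fin 3))).restrict S ∧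
          ∀ p ∈ S, HasSum (fun q : {q : EuclideanSpace ℝ (Fin 3) // q ∈ S ∧ q ≠ p} =>
            (deriv lennardJones (dist p q.1) / dist p q.1) • (p - q.1)) 0) →
        (∀ M : EuclideanSpace ℝ (Fin 3) →L[ℝ] EuclideanSpace ℝ (Fin 3),
          ∫ μ, (∫ y, deriv lennardJones ‖y‖ / ‖y‖ * inner ℝ y (M y) ∂μ) ∂P = 0) →
        (∫ μ, (∫ y, lennardJones ‖y‖ ∂μ) / 2 ∂P) ≤ (⨅ Q : PeriodicConfiguration 3, Q.energyPerParticle lennardJones) →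
        ∀ᵐ μ ∂P,
          (starDefect a₀ h₀ μ = 0 ∨
            (⨅ A : EuclideanSpace ℝ (Fin 3) ≃ₗᵢ[ℝ] EuclideanSpace ℝ (Fin 3),
              ∑ p ∈ fccKissingPattern, Metric.infDist (A (a₀ • p)) (rootStar μ) ^ 2) = 0) ∧
          μ {y : EuclideanSpace ℝ (Fin 3) | 11 / 10 < ‖y‖ ∧ ‖y‖ ≤ 5 / 4} = 0) :
    ∀ δ : ℝ, 0 < δ → ∀ P : Measure (Measure (EuclideanSpace ℝ (Fin 3))), IsProbabilityMeasure P →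
      (∀ᵐ μ ∂P, IsRootedHardCore δ μ) → IsPointStationaryLaw P →
      (∫ μ, (∫ y, lennardJones ‖y‖ ∂μ) / 2 ∂P) ≤
        (⨅ Q : PeriodicConfiguration 3, Q.energyPerParticle lennardJones) →
      (∀ᵐ μ ∂P, ∃ S : Set (EuclideanSpace ℝ (Fin 3)),
        μ = (Measure.count : Measure (EuclideanSpace ℝ (Fin 3))).restrict S ∧ ∀ y ∈ S, SetGood S y) →
      ∀ᵐ μ ∂P, ∃ a h : ℝ, ∃ ha : a ≠ 0, ∃ hh : h ≠ 0, 1 / 2 ≤ a ∧ a ≤ 2 ∧ 1 / 2 ≤ h ∧ h ≤ 2 ∧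
        ∃ A : EuclideanSpace ℝ (Fin 3) ≃ₗᵢ[ℝ] EuclideanSpace ℝ (Fin 3),
          (hcpPeriodicConfiguration ha hh).energyPerParticle lennardJones =
            (⨅ Q : PeriodicConfiguration 3, Q.energyPerParticle lennardJones) ∧
          μ = (Measure.count : Measure (EuclideanSpace ℝ (Fin 3))).restrict (A '' hcpStacking a h) := by
  intro δ hδ P hP hcore hstat hE hgood
  -- R1 (landed): chart the funnel
  have hchart : ∀ᵐ μ ∂P, ∃ S : Set (EuclideanSpace ℝ (Fin 3)),
      μ = (Measure.count : Measure (EuclideanSpace ℝ (Fin 3))).restrict S ∧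
      (∀ y ∈ S, SetGood S y) ∧
      ∃ s : ℤ → ℤ, IsHaggSeq s ∧
        ∃ Φ : EuclideanSpace ℝ (Fin 3) → EuclideanSpace ℝ (Fin 3),
          Set.BijOn Φ (barlowStacking 1 (Real.sqrt (2 / 3)) s) S ∧
          ∀ p ∈ barlowStacking 1 (Real.sqrt (2 / 3)) s, ∀ q ∈ barlowStacking 1 (Real.sqrt (2 / 3)) s,
            (dist p q = 1 ↔ (0 < dist (Φ p) (Φ q) ∧ dist (Φ p) (Φ q) < 6 / 5)) := by
    filter_upwards [hcore, hgood] with μ hc hg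
    obtain ⟨S, rfl, hS⟩ := hg
    obtain ⟨S₀, h0, -, hμ⟩ := hc
    have h0S : (0 : EuclideanSpace ℝ (Fin 3)) ∈ S := by
      have h1 : (Measure.count : Measure (EuclideanSpace ℝ (Fin 3))).restrict S {0} ≠ 0 := by
        rw [hμ]
        exact (count_restrict_singleton_ne_zero_iff S₀ 0).2 h0
      exact (count_restrict_singleton_ne_zero_iff S 0).1 h1
    obtain ⟨s, hs, Φ, hΦ, hbond⟩ :=
      Summit.AtomisticToContinuum.Crystallization.Theorems.PalmGoodLaw.FunnelChart.stub_funnelChart S ⟨0, h0S⟩ hS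
    exact ⟨S, rfl, hS, s, hs, Φ, hΦ, hbond⟩
  -- the relaxed reference and the level `E_P[h] ≤ e* ≤ hcpE a₀ h₀`
  obtain ⟨a₀, h₀, ha₁, ha₂, hh₁, hh₂, hmin⟩ := stub_relaxedReference
  have ha0 : 0 < a₀ := by linarith
  have hh0 : 0 < h₀ := by linarith
  have hstar : (⨅ Q : PeriodicConfiguration 3, Q.energyPerParticle lennardJones) ≤ hcpE a₀ h₀ :=
    Summit.AtomisticToContinuum.Crystallization.Theorems.PalmGoodLaw.RouteBetaFloor.iInf_le_hcpE ha0.ne' hh0.ne'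
  have hlevel : (∫ μ, (∫ y, lennardJones ‖y‖ ∂μ) / 2 ∂P) ≤ hcpE a₀ h₀ := hE.trans hstar
  -- the `e*`-level structure of minimising laws (landed)
  have hFB := Summit.AtomisticToContinuum.Crystallization.Theorems.PalmGoodLaw.RouteBetaFloor.ae_forceBalance_of_minimising
    hδ hcore hstat hE
  have hZS := Summit.AtomisticToContinuum.Crystallization.Theorems.PalmGoodLaw.RouteBetaFloor.zeroMeanStress_of_minimising
    hδ hcore hstat hE
  -- item 3061: the level IS the periodic infimum; FUNNEL EQUALITY: the ROOT star is a.s. exact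
  have heq : hcpE a₀ h₀ = ⨅ Q : PeriodicConfiguration 3, Q.energyPerParticle lennardJones :=
    hcpE_eq_iInf_of_isLeast h3061 ha0 hh0 hmin
  have hexact := hEQ a₀ h₀ ha₁ ha₂ hh₁ hh₂ hmin δ hδ P hP hcore hstat hchart hFB hZS hE
  -- every point a.s. (Aldous–Lyons; hard-core configurations are locally finite)
  have hlf : ∀ᵐ μ ∂P, ∀ n : ℕ,
      μ ((fun z : EuclideanSpace ℝ (Fin 3) => ⌊‖z‖⌋₊) ⁻¹' {n}) < ∞ := by
    filter_upwards [hcore] with μ hμ n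
    obtain ⟨S, -, hsep, rfl⟩ := hμ
    exact count_restrict_floorNorm_preimage_lt_top hδ hsep n
  have hall := ae_forall_map_sub_of_ae hstat hlf hexact
  -- X2: a.s. an exact stacking
  have hstack : ∀ᵐ μ ∂P, ∃ A : EuclideanSpace ℝ (Fin 3) ≃ₗᵢ[ℝ] EuclideanSpace ℝ (Fin 3), ∃ h : ℝ,
      (h = h₀ ∨ h = a₀ * Real.sqrt (2 / 3)) ∧ ∃ s : ℤ → ℤ, IsHaggSeq s ∧
        μ = (Measure.count : Measure (EuclideanSpace ℝ (Fin 3))).restrict (A '' barlowStacking a₀ h s) := by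
    filter_upwards [hcore, hchart, hall] with μ hc hch ha
    obtain ⟨S, hμS, hgoodS, hch'⟩ := hch
    obtain ⟨S₀, h0, -, hμ0⟩ := hc
    have h0S : (0 : EuclideanSpace ℝ (Fin 3)) ∈ S := by
      have h1 : (Measure.count : Measure (EuclideanSpace ℝ (Fin 3))).restrict S {0} ≠ 0 := by
        rw [← hμS, hμ0]
        exact (count_restrict_singleton_ne_zero_iff S₀ 0).2 h0
      exact (count_restrict_singleton_ne_zero_iff S 0).1 h1
    have hx : ∀ x ∈ S,
        (starDefect a₀ h₀
            ((Measure.count : Measure (EuclideanSpace ℝ (Fin 3))).restrict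
              ((fun z : EuclideanSpace ℝ (Fin 3) => z - x) '' S)) = 0 ∨
          (⨅ A : EuclideanSpace ℝ (Fin 3) ≃ₗᵢ[ℝ] EuclideanSpace ℝ (Fin 3),
            ∑ p ∈ fccKissingPattern, Metric.infDist (A (a₀ • p))
              (rootStar ((Measure.count : Measure (EuclideanSpace ℝ (Fin 3))).restrict
                ((fun z : EuclideanSpace ℝ (Fin 3) => z - x) '' S))) ^ 2) = 0) ∧
        (Measure.count : Measure (EuclideanSpace ℝ (Fin 3))).restrict ((fun z : EuclideanSpace ℝ (Fin 3) => z - x) '' S)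
          {y : EuclideanSpace ℝ (Fin 3) | 11 / 10 < ‖y‖ ∧ ‖y‖ ≤ 5 / 4} = 0 := by
      intro x hxS
      have h1 := ha x (by rw [hμS]; exact (count_restrict_singleton_ne_zero_iff S x).2 hxS)
      rwa [hμS, map_sub_count_restrict] at h1
    obtain ⟨A, h, hh, s', hs', hS⟩ := ExactStarShortcutRigidity.stub_exactStarRigidity a₀ h₀ ha₁ ha₂ hh₁ hh₂ S h0S hgoodS hch' hx
    exact ⟨A, h, hh, s', hs', by rw [hμS, hS]⟩
  -- X3: a.s. exact relaxed hcp
  have hhcp := ExactSelectionLawB.stub_exactSelectionLawB a₀ h₀ ha₁ ha₂ hh₁ hh₂ hmin δ hδ P hP hcore hstat hlevel hstack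
  filter_upwards [hhcp] with μ hμ
  obtain ⟨A, hA⟩ := hμ
  refine ⟨a₀, h₀, ha0.ne', hh0.ne', by linarith, by linarith, by linarith, by linarith, A, ?_, hA⟩
  rw [← heq]
  exact ((Summit.AtomisticToContinuum.Crystallization.Theorems.ExcessDecayLiouvilleCoarseGrains.hcpEnergySeries_of_eq
    a₀ h₀ ha0.ne' hh0.ne' hcpQ rfl).2.2)

/-- **THE RESIDUE OF CRUX 13603 IN GROUND-STATE FORM (lead c9, v32): item 3061 `HcpPeriodicMinimiser` (verbatim) and GROUND-STATE FUNNEL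
EQUALITY prove `DefectFreeCrystallizes`.**  Registered stub of the skeleton v32: `stub_funnelEquality` = the hypothesis `hEQ` here, verbatim;
glue-by anchor `defectFreeCrystallizes_of_groundStateEquality`. [folklore] -/
theorem defectFreeCrystallizes_of_groundStateEquality :
    (∃ a h : ℝ, ∃ (ha : a ≠ 0) (hh : h ≠ 0), 47 / 50 ≤ a ∧ a ≤ 1 ∧ 39 / 50 * a ≤ h ∧ h ≤ 17 / 20 * a ∧ IsLeast (Set.range fun Q : Literature.MathematicalPhysics.StatisticalMechanics.PeriodicConfiguration 3 => Q.energyPerParticle Literature.MathematicalPhysics.StatisticalMechanics.lennardJones) ((Literature.MathematicalPhysics.StatisticalMechanics.hcpPeriodicConfiguration ha hh).energyPerParticle Literature.MathematicalPhysics.StatisticalMechanics.lennardJones)) →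
    (∀ a₀ h₀ : ℝ, 189 / 200 ≤ a₀ → a₀ ≤ 199 / 200 → 77 / 100 ≤ h₀ → h₀ ≤ 163 / 200 →
      (∀ a h : ℝ, 0 < a → 0 < h → Summit.AtomisticToContinuum.Crystallization.Theorems.PalmUnimodularRigidity.LayeredLawsSelectHcp.hcpE a₀ h₀ ≤ Summit.AtomisticToContinuum.Crystallization.Theorems.PalmUnimodularRigidity.LayeredLawsSelectHcp.hcpE a h) →
      ∀ δ : ℝ, 0 < δ → ∀ P : Measure (Measure (EuclideanSpace ℝ (Fin 3))), IsProbabilityMeasure P →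
        (∀ᵐ μ ∂P, IsRootedHardCore δ μ) → IsPointStationaryLaw P →
        (∀ᵐ μ ∂P, ∃ S : Set (EuclideanSpace ℝ (Fin 3)),
          μ = (Measure.count : Measure (EuclideanSpace ℝ (Fin 3))).restrict S ∧
          (∀ y ∈ S, SetGood S y) ∧
          ∃ s : ℤ → ℤ, IsHaggSeq s ∧
            ∃ Φ : EuclideanSpace ℝ (Fin 3) → EuclideanSpace ℝ (Fin 3),
              Set.BijOn Φ (barlowStacking 1 (Real.sqrt (2 / 3)) s) S ∧
              ∀ p ∈ barlowStacking 1 (Real.sqrt (2 / 3)) s, ∀ q ∈ barlowStacking 1 (Real.sqrt (2 / 3)) s,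
                (dist p q = 1 ↔ (0 < dist (Φ p) (Φ q) ∧ dist (Φ p) (Φ q) < 6 / 5))) →
        (∀ᵐ μ ∂P, ∃ S : Set (EuclideanSpace ℝ (Fin 3)),
          μ = (Measure.count : Measure (EuclideanSpace ℝ (Fin 3))).restrict S ∧
          ∀ p ∈ S, HasSum (fun q : {q : EuclideanSpace ℝ (Fin 3) // q ∈ S ∧ q ≠ p} =>
            (deriv lennardJones (dist p q.1) / dist p q.1) • (p - q.1)) 0) →
        (∀ M : EuclideanSpace ℝ (Fin 3) →L[ℝ] EuclideanSpace ℝ (Fin 3),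
          ∫ μ, (∫ y, deriv lennardJones ‖y‖ / ‖y‖ * inner ℝ y (M y) ∂μ) ∂P = 0) →
        (∫ μ, (∫ y, lennardJones ‖y‖ ∂μ) / 2 ∂P) ≤ (⨅ Q : Literature.MathematicalPhysics.StatisticalMechanics.PeriodicConfiguration 3, Q.energyPerParticle Literature.MathematicalPhysics.StatisticalMechanics.lennardJones) →
        ∀ᵐ μ ∂P,
          (Summit.AtomisticToContinuum.Crystallization.Theorems.PalmUnimodularRigidity.LayeredLawsSelectHcp.starDefect a₀ h₀ μ = 0 ∨
            (⨅ A : EuclideanSpace ℝ (Fin 3) ≃ₗᵢ[ℝ] EuclideanSpace ℝ (Fin 3),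
              ∑ p ∈ fccKissingPattern, Metric.infDist (A (a₀ • p)) (Summit.AtomisticToContinuum.Crystallization.Theorems.PalmUnimodularRigidity.LayeredLawsSelectHcp.rootStar μ) ^ 2) = 0) ∧
          μ {y : EuclideanSpace ℝ (Fin 3) | 11 / 10 < ‖y‖ ∧ ‖y‖ ≤ 5 / 4} = 0) →
    Summit.AtomisticToContinuum.Crystallization.Theses.ReggeStarCoercivity.DefectFreeCrystallizes := fun h3061 hEQ =>
  defectFreeCrystallizes_iff.2 fun hZ =>
    Summit.AtomisticToContinuum.Crystallization.Theorems.chargedPatternCrystallizes_proof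
      (Summit.AtomisticToContinuum.Crystallization.Theorems.PalmGoodLaw.ChargeFromFunnelLaw.stub_chargeFromFunnelLaw
        Summit.AtomisticToContinuum.Crystallization.Theorems.PalmGoodLaw.stub_goodLaw
        (funnelLawRigidity_of_groundStateEquality h3061 hEQ) hZ)
      LennardJonesMinimalDistance_holds

end ExactStarGlue

end Summit.AtomisticToContinuum.Crystallization.Theorems.PalmGoodLaw.ExactStarShortcutGroundState

end
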